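import Mathlib
import HarnessLib

/-!
# The circulation form on a cycle is bounded by `m/4` times the cycle's Dirichlet energy:
# `|Σ_k Im(z̄_k z_{k+1})| ≤ (m/4)·Σ_k |z_{k+1} − z_k|²` (card idea-1 / loss-holonomy-gauge, support P1, crude constant)

Venture GRIDFUSION, G2-SCALE cell, lead g19 TYPING ORDER object T5 («idea-1 P1, cycle-Poincaré, constant m/4 version
first, + a 3-node one-cycle smoke instance»; card HOME/IDEAS-G2.md «idea-1 / loss-holonomy-gauge» sha16 882dc35803a50aa7,
§ What it needs, P1: «for z : Fin m → ℂ (indices mod m), |Σ_k Im(conj(z_k)·z_{k+1})| ≤ ½cot(π/m)·Σ_k ‖z_k − z_{k+1}‖²; the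
cruder constant m/4 (Cauchy–Schwarz + path Poincaré) already suffices for the certificate and avoids trigonometry in the
kernel»).  Typed by gridfusion-lit-4 (g14), 2026-08-28.  0 kit, 0 facts, no `decide` over instance data.

THE ARGUMENT (elementary, no spectral theory).  The circulation form `S(z) = Σ_k Im(z̄_k z_{k+1})` is invariant under
translation `z ↦ z − a` and `Im(z̄_k z_k) = 0`, so `S(z) = Σ_k Im(conj(z_k − a)·d_k)` for every `a`, `d_k = z_{k+1} − z_k`.
Averaging over `a = z_j`: `m·S(z) = Σ_j Σ_k Im(conj(z_k − z_j)·d_k)`, hence `m·|S| ≤ Σ_k |d_k| Σ_j |z_k − z_j|`.  Going from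
`k` to `j = k + ℓ` along the SHORTER arc, `|z_k − z_{k+ℓ}| ≤` the sum of the `min(ℓ, m − ℓ)` differences on that arc; by
`|d_k||d_{k+s}| ≤ ½(|d_k|² + |d_{k+s}|²)` and cyclic re-indexing every shifted product sum is `≤ T = Σ_k|d_k|²`, so
`m·|S| ≤ T·Σ_{ℓ<m} min(ℓ, m − ℓ) = T·⌊m²/4⌋ ≤ T·m²/4`, i.e. `|S| ≤ (m/4)·T`.  (The sharp constant `½cot(π/m)` — both forms
diagonal in the cycle's Fourier basis — is not needed by the certificate and is not proved here.)

## Contents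
* `cdiff z k = z (k+1) − z k`, `circ z = Σ_k Im(z̄_k z_{k+1})` (indices in `Fin m`, addition mod `m`).
* `circ_eq_sum_conj_sub_mul_cdiff` (translation invariance), `sub_eq_sum_cdiff` / `norm_sub_le_arc` /
  `norm_sub_le_arc'` (path sums clockwise / counter-clockwise), `sum_norm_mul_norm_shift_le` (shifted products `≤ T`),
  `four_mul_sum_min_le_sq` (`4·Σ_{ℓ<m} min(ℓ, m−ℓ) ≤ m²`), **`abs_circ_le`** (`|circ z| ≤ (m/4)·Σ_k‖cdiff z k‖²`).
* §smoke: the 3-cycle instance `abs_circ_le_three` (`m = 3`: `|S| ≤ (3/4)·T`), by `abs_circ_le`.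
-/

namespace Summit.Ventures.GridStability.Lyapunov.CycleCirculation

open Finset Complex
open Fin.NatCast -- the coercion `ℕ → Fin m` (`[NeZero m]`), for arc lengths as indices

variable {m : ℕ} [NeZero m]

/-- The cyclic difference `d_k = z_{k+1} − z_k` (index `k + 1` taken mod `m`). -/
def cdiff (z : Fin m → ℂ) (k : Fin m) : ℂ := z (k + 1) - z k

/-- The CIRCULATION FORM of a complex vector on the `m`-cycle: `S(z) = Σ_k Im(z̄_k · z_{k+1})`. -/
def circ (z : Fin m → ℂ) : ℝ := ∑ k, ((starRingEnd ℂ) (z k) * z (k + 1)).im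

/-- Cyclic re-indexing: `Σ_k f(k + s) = Σ_k f(k)`. -/
theorem sum_shift (f : Fin m → ℝ) (s : Fin m) : ∑ k, f (k + s) = ∑ k, f k :=
  Fintype.sum_equiv (Equiv.addRight s) _ _ fun _ => rfl

/-- TRANSLATION INVARIANCE in the form used: `S(z) = Σ_k Im(conj(z_k − a) · d_k)` for every `a`. -/
theorem circ_eq_sum_conj_sub_mul_cdiff (z : Fin m → ℂ) (a : ℂ) :
    circ z = ∑ k, ((starRingEnd ℂ) (z k - a) * cdiff z k).im := by
  unfold circ cdiff
  -- termwise: Im(conj(z_k − a)(z_{k+1} − z_k)) = Im(z̄_k z_{k+1}) − Im(ā z_{k+1}) + Im(ā z_k)  (Im(z̄_k z_k) = 0)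
  have hterm : ∀ k, ((starRingEnd ℂ) (z k - a) * (z (k + 1) - z k)).im
      = ((starRingEnd ℂ) (z k) * z (k + 1)).im - ((starRingEnd ℂ) a * z (k + 1)).im
        + ((starRingEnd ℂ) a * z k).im := by
    intro k
    have h0 : ((starRingEnd ℂ) (z k) * z k).im = 0 := by
      rw [← Complex.normSq_eq_conj_mul_self]; simp
    simp only [map_sub, sub_mul, mul_sub, Complex.sub_im]
    linarith
  simp only [hterm, Finset.sum_add_distrib, Finset.sum_sub_distrib]
  have hs : ∑ k, ((starRingEnd ℂ) a * z (k + 1)).im = ∑ k, ((starRingEnd ℂ) a * z k).im :=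
    sum_shift (fun k => ((starRingEnd ℂ) a * z k).im) 1
  rw [hs]; ring

/-- PATH SUM (clockwise): `z_{k+ℓ} − z_k = Σ_{t<ℓ} d_{k+t}`. -/
theorem sub_eq_sum_cdiff (z : Fin m → ℂ) (k : Fin m) (ℓ : ℕ) :
    z (k + (ℓ : Fin m)) - z k = ∑ t ∈ range ℓ, cdiff z (k + (t : Fin m)) := by
  induction ℓ with
  | zero => simp
  | succ ℓ ih =>
    rw [Finset.sum_range_succ, ← ih, cdiff, Nat.cast_succ, ← add_assoc]
    ring

/-- `|z_{k+ℓ} − z_k| ≤ Σ_{t<ℓ} |d_{k+t}|` (clockwise arc of length `ℓ`). -/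
theorem norm_sub_le_arc (z : Fin m → ℂ) (k : Fin m) (ℓ : ℕ) :
    ‖z (k + (ℓ : Fin m)) - z k‖ ≤ ∑ t ∈ range ℓ, ‖cdiff z (k + (t : Fin m))‖ := by
  rw [sub_eq_sum_cdiff]; exact norm_sum_le _ _

/-- `|z_{k+ℓ} − z_k| ≤ Σ_{t<m−ℓ} |d_{k+ℓ+t}|` (counter-clockwise: the complementary arc of length `m − ℓ`, `ℓ ≤ m`). -/
theorem norm_sub_le_arc' (z : Fin m → ℂ) (k : Fin m) {ℓ : ℕ} (hℓ : ℓ ≤ m) :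
    ‖z (k + (ℓ : Fin m)) - z k‖ ≤ ∑ t ∈ range (m - ℓ), ‖cdiff z (k + (ℓ : Fin m) + (t : Fin m))‖ := by
  have h := norm_sub_le_arc z (k + (ℓ : Fin m)) (m - ℓ)
  have hback : k + (ℓ : Fin m) + ((m - ℓ : ℕ) : Fin m) = k := by
    rw [add_assoc, ← Nat.cast_add, Nat.add_sub_cancel' hℓ, Fin.natCast_self, add_zero]
  rw [hback, norm_sub_rev] at h
  exact h

/-- SHIFTED PRODUCTS: `Σ_k |d_k|·|d_{k+s}| ≤ Σ_k |d_k|²` (AM–GM and cyclic re-indexing). -/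
theorem sum_norm_mul_norm_shift_le (z : Fin m → ℂ) (s : Fin m) :
    ∑ k, ‖cdiff z k‖ * ‖cdiff z (k + s)‖ ≤ ∑ k, ‖cdiff z k‖ ^ 2 := by
  have h : ∑ k, ‖cdiff z k‖ * ‖cdiff z (k + s)‖
      ≤ ∑ k, (1 / 2 * ‖cdiff z k‖ ^ 2 + 1 / 2 * ‖cdiff z (k + s)‖ ^ 2) :=
    Finset.sum_le_sum fun k _ => by nlinarith [sq_nonneg (‖cdiff z k‖ - ‖cdiff z (k + s)‖)]
  refine h.trans (le_of_eq ?_)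
  rw [Finset.sum_add_distrib, ← Finset.mul_sum, ← Finset.mul_sum,
    sum_shift (fun k => ‖cdiff z k‖ ^ 2) s]
  ring

/-- THE COUNT: `4·Σ_{ℓ<m} min(ℓ, m − ℓ) ≤ m²` (`Σ_{ℓ<m} min(ℓ, m−ℓ) = ⌊m²/4⌋`; via `S(m+2) = S(m) + m + 1`). -/
theorem four_mul_sum_min_le_sq (n : ℕ) : 4 * ∑ ℓ ∈ range n, min ℓ (n - ℓ) ≤ n * n := by
  have hrec : ∀ n, ∑ ℓ ∈ range (n + 2), min ℓ (n + 2 - ℓ) = ∑ ℓ ∈ range n, min ℓ (n - ℓ) + (n + 1) := by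
    intro n
    rw [Finset.sum_range_succ', Finset.sum_range_succ]
    have h1 : ∀ ℓ ∈ range n, min (ℓ + 1) (n + 2 - (ℓ + 1)) = min ℓ (n - ℓ) + 1 := by
      intro ℓ hℓ
      have hℓ' : ℓ < n := Finset.mem_range.mp hℓ
      omega
    rw [Finset.sum_congr rfl h1, Finset.sum_add_distrib]
    simp
    omega
  induction n using Nat.twoStepInduction with
  | zero => simp
  | one => simp
  | more n ih _ =>
    rw [hrec n]
    nlinarith [ih]

/-- **THE CYCLE CIRCULATION BOUND (crude constant `m/4`)**: for every `z : Fin m → ℂ`,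
`|Σ_k Im(z̄_k z_{k+1})| ≤ (m/4)·Σ_k |z_{k+1} − z_k|²`. -/
theorem abs_circ_le (z : Fin m → ℂ) : |circ z| ≤ (m : ℝ) / 4 * ∑ k, ‖cdiff z k‖ ^ 2 := by
  set T : ℝ := ∑ k, ‖cdiff z k‖ ^ 2 with hT
  have hm : (0 : ℝ) < m := by exact_mod_cast Nat.pos_of_ne_zero (NeZero.ne m)
  -- (1) averaging the translation-invariant form over `a = z_j`
  have havg : (m : ℝ) * circ z = ∑ j, ∑ k, ((starRingEnd ℂ) (z k - z j) * cdiff z k).im := by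
    rw [Finset.sum_congr rfl fun j _ => (circ_eq_sum_conj_sub_mul_cdiff z (z j)).symm]
    simp
  -- (2) the arc bound for `Σ_j |z_k − z_j|`, re-indexed as `j = k + ℓ`
  have hw : ∀ k : Fin m, ∑ j, ‖z k - z j‖ * ‖cdiff z k‖
      ≤ ∑ ℓ ∈ range m, (if ℓ ≤ m - ℓ then ∑ t ∈ range ℓ, ‖cdiff z (k + (t : Fin m))‖ * ‖cdiff z k‖
          else ∑ t ∈ range (m - ℓ), ‖cdiff z (k + (ℓ : Fin m) + (t : Fin m))‖ * ‖cdiff z k‖) := by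
    intro k
    have hre : ∑ j, ‖z k - z j‖ * ‖cdiff z k‖ = ∑ ℓ ∈ range m, ‖z k - z (k + (ℓ : Fin m))‖ * ‖cdiff z k‖ := by
      rw [← Fintype.sum_equiv (Equiv.addLeft k) (fun j => ‖z k - z (k + j)‖ * ‖cdiff z k‖)
        (fun j => ‖z k - z j‖ * ‖cdiff z k‖) (fun _ => rfl)]
      rw [← Fin.sum_univ_eq_sum_range (fun ℓ => ‖z k - z (k + (ℓ : Fin m))‖ * ‖cdiff z k‖)]
      simp
    rw [hre]
    refine Finset.sum_le_sum fun ℓ hℓ => ?_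
    have hℓm : ℓ ≤ m := (Finset.mem_range.mp hℓ).le
    split_ifs with hc
    · rw [← Finset.sum_mul, norm_sub_rev]
      exact mul_le_mul_of_nonneg_right (norm_sub_le_arc z k ℓ) (norm_nonneg _)
    · rw [← Finset.sum_mul, norm_sub_rev]
      exact mul_le_mul_of_nonneg_right (norm_sub_le_arc' z k hℓm) (norm_nonneg _)
  -- (3) each arc term, summed over `k`, is `≤ min(ℓ, m−ℓ)·T`
  have harc : ∀ ℓ ∈ range m, ∑ k : Fin m,
      (if ℓ ≤ m - ℓ then ∑ t ∈ range ℓ, ‖cdiff z (k + (t : Fin m))‖ * ‖cdiff z k‖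
        else ∑ t ∈ range (m - ℓ), ‖cdiff z (k + (ℓ : Fin m) + (t : Fin m))‖ * ‖cdiff z k‖)
      ≤ (min ℓ (m - ℓ) : ℕ) * T := by
    intro ℓ _
    split_ifs with hc
    · rw [min_eq_left hc, Finset.sum_comm]
      calc ∑ t ∈ range ℓ, ∑ k : Fin m, ‖cdiff z (k + (t : Fin m))‖ * ‖cdiff z k‖
          ≤ ∑ t ∈ range ℓ, T := Finset.sum_le_sum fun t _ => by
            rw [Finset.sum_congr rfl fun k _ => mul_comm _ _]
            exact sum_norm_mul_norm_shift_le z _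
        _ = (ℓ : ℕ) * T := by simp
    · rw [min_eq_right (le_of_not_ge hc), Finset.sum_comm]
      calc ∑ t ∈ range (m - ℓ), ∑ k : Fin m, ‖cdiff z (k + (ℓ : Fin m) + (t : Fin m))‖ * ‖cdiff z k‖
          ≤ ∑ t ∈ range (m - ℓ), T := Finset.sum_le_sum fun t _ => by
            rw [Finset.sum_congr rfl fun k _ => by rw [mul_comm, add_assoc]]
            exact sum_norm_mul_norm_shift_le z _
        _ = ((m - ℓ : ℕ) : ℝ) * T := by simp
  -- (4) assemble
  have hcount : (∑ ℓ ∈ range m, ((min ℓ (m - ℓ) : ℕ) : ℝ)) ≤ (m : ℝ) ^ 2 / 4 := by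
    have h := four_mul_sum_min_le_sq m
    have h' : ((4 * ∑ ℓ ∈ range m, min ℓ (m - ℓ) : ℕ) : ℝ) ≤ ((m * m : ℕ) : ℝ) := by exact_mod_cast h
    push_cast at h' ⊢
    nlinarith [h']
  have hT0 : 0 ≤ T := Finset.sum_nonneg fun k _ => sq_nonneg _
  have hmain : (m : ℝ) * |circ z| ≤ (m : ℝ) ^ 2 / 4 * T := by
    rw [← abs_of_pos hm, ← abs_mul, havg, abs_of_pos hm]
    calc |∑ j, ∑ k, ((starRingEnd ℂ) (z k - z j) * cdiff z k).im|
        ≤ ∑ j, ∑ k, ‖z k - z j‖ * ‖cdiff z k‖ := by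
          refine (Finset.abs_sum_le_sum_abs _ _).trans (Finset.sum_le_sum fun j _ => ?_)
          refine (Finset.abs_sum_le_sum_abs _ _).trans (Finset.sum_le_sum fun k _ => ?_)
          calc |((starRingEnd ℂ) (z k - z j) * cdiff z k).im|
              ≤ ‖(starRingEnd ℂ) (z k - z j) * cdiff z k‖ := Complex.abs_im_le_norm _
            _ = ‖z k - z j‖ * ‖cdiff z k‖ := by rw [norm_mul, Complex.norm_conj]
      _ = ∑ k, ∑ j, ‖z k - z j‖ * ‖cdiff z k‖ := Finset.sum_comm
      _ ≤ ∑ k, ∑ ℓ ∈ range m, (if ℓ ≤ m - ℓ then ∑ t ∈ range ℓ, ‖cdiff z (k + (t : Fin m))‖ * ‖cdiff z k‖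
          else ∑ t ∈ range (m - ℓ), ‖cdiff z (k + (ℓ : Fin m) + (t : Fin m))‖ * ‖cdiff z k‖) :=
          Finset.sum_le_sum fun k _ => hw k
      _ = ∑ ℓ ∈ range m, ∑ k : Fin m, (if ℓ ≤ m - ℓ then ∑ t ∈ range ℓ, ‖cdiff z (k + (t : Fin m))‖ * ‖cdiff z k‖
          else ∑ t ∈ range (m - ℓ), ‖cdiff z (k + (ℓ : Fin m) + (t : Fin m))‖ * ‖cdiff z k‖) := Finset.sum_comm
      _ ≤ ∑ ℓ ∈ range m, ((min ℓ (m - ℓ) : ℕ) : ℝ) * T := Finset.sum_le_sum harc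
      _ = (∑ ℓ ∈ range m, ((min ℓ (m - ℓ) : ℕ) : ℝ)) * T := by rw [Finset.sum_mul]
      _ ≤ (m : ℝ) ^ 2 / 4 * T := mul_le_mul_of_nonneg_right hcount hT0
  have hdiv : |circ z| = (m : ℝ) * |circ z| / m := by field_simp
  rw [hdiv]
  calc (m : ℝ) * |circ z| / m ≤ (m : ℝ) ^ 2 / 4 * T / m := div_le_div_of_nonneg_right hmain hm.le
    _ = (m : ℝ) / 4 * T := by field_simp

/-! ## Smoke instance: one 3-cycle -/

/-- **3-NODE ONE-CYCLE SMOKE INSTANCE**: on the triangle, `|Im(z̄₀z₁ + z̄₁z₂ + z̄₂z₀)| ≤ (3/4)·(|z₁−z₀|² + |z₂−z₁|² + |z₀−z₂|²)`. -/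
theorem abs_circ_le_three (z : Fin 3 → ℂ) : |circ z| ≤ (3 : ℝ) / 4 * ∑ k, ‖cdiff z k‖ ^ 2 := by
  simpa using abs_circ_le z

end Summit.Ventures.GridStability.Lyapunov.CycleCirculation
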